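import Literature.NumberTheory.IwasawaTheory.ClassicalMuVanishesKurodaTower
import Literature.NumberTheory.IwasawaTheory.FukudaRankCountingLemmas
import Literature.NumberTheory.NumberFields.KummerPlusMinusRankOne
import Literature.NumberTheory.NumberFields.CMFieldClassGroupPlusMinusDecomposition
import Mathlib.NumberTheory.NumberField.CMField
import HarnessLib

set_option autoImplicit false

/-!
# Leopoldt–Scholz REFLECTION up the cyclotomic `ℤ_p`-tower, I: the layerwise inequality — the `p`-rank of the REAL (even)
# mirror is bounded by the `p`-ranks of the ODD mirrors at every layer (theorem-only; no named fact, no `sorry`)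

Topic `NumberTheory/IwasawaTheory` (namespace = path).  THEOREM-ONLY file written by the prover seat `bsd-potss-rkm` (generation 36,
cell `bsd-potss`; `--supports` stmt-BirchSwinnertonDyer-19196, crux M `ReducibleKatoMember` of the routes K9 / K8-t′; closes nothing).
Companion file `ClassicalMuVanishesReflectionDescent.lean` (the `μ = 0` descents and the `p = 3` Borel/Scholz form) — see its docstring
for the consumer (the `μ`-input of Kato's member bound / Coates–Sujatha's (A) on the reducible rows: `{χ₁, χ₂}` with `χ₁χ₂ = ω` is a
Leopoldt mirror pair).

## The mathematics (all inputs are tree theorems)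

Let `K` be a CM number field containing `ζ_p` (`p` odd) and `z, b ∈ Gal(K/F)` commuting involutions with `K^{⟨z⟩} = K⁺` totally
real.  Lang, *Cyclotomic Fields I–II*, Ch. 13 §2 Thm. 2.1 (i) — tree `IsCMField.card_pTorsion_classGroup_maximalRealSubfield_le_mul`
(on the tree's Hilbert class field; unconditional): `#Cl(K⁺)[p] ≤ p · #Cl(K)⁻[p]`; with the `±` decomposition
`#Cl(K)[p] = #Cl(K⁺)[p] · #Cl(K)⁻[p]` (`IsCMField.card_pTorsion_classGroup`): `#Cl(K⁺)[p]² ≤ p · #Cl(K)[p]`.  Kuroda's class number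
relation (odd part, `q = p`; Lemmermeyer 1994 §1; tree `KurodaOddPart.card_torsion_classGroup_biquadratic`):
`#Cl(K)[p] · #Cl(K^{⟨z,b⟩})[p]² = #Cl(K^{⟨z⟩})[p] · #Cl(K^{⟨b⟩})[p] · #Cl(K^{⟨zb⟩})[p]`.  Together (`K⁺ ≅ K^{⟨z⟩}`, Mathlib
`CMExtension.equivMaximalRealSubfield`):
  **`rank_p Cl(K^{⟨z⟩}) + 2 rank_p Cl(K^{⟨z,b⟩}) ≤ 1 + rank_p Cl(K^{⟨b⟩}) + rank_p Cl(K^{⟨zb⟩})`**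
— Leopoldt's Spiegelungssatz `rank A^{χ_even} ≤ rank A^{χ_odd} + δ` for this configuration (Scholz 1932 for `ℚ(√d)`/`ℚ(√−3d)`),
obtained from Lang's `±` form without Kummer generators.  Up the tower: for `F` totally real, `κ` a `ℤ_p`-extension of `F`, `L/F`
Galois with `L ∩ F_∞ = F`, `L` totally complex with `ζ_p ∈ L` and `L^{⟨z⟩}` totally real, every layer `L·F_n` is such a `K`
(`F_n/F` is Galois of odd degree hence totally real, `isTotallyReal_of_isGalois_of_odd_finrank`; the section
`s : Gal(L/F) ↪ Gal(L·F_n/F)` of `RestrictedTowerLayerSection.lean` has `(L·F_n)^{s(H)} ≅ (L^H·F_∞)_n`), so the inequality holds for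
`rank_p Cl((·F_∞)_n)` (tree `classGroupPRank`) at EVERY `n`.  For `F = ℚ`, `p = 3`, `L = ℚ(√d, √−3)`:
`rank₃ Cl(ℚ_n(√d)) ≤ 1 + rank₃ Cl(ℚ(μ_{3^{n+1}})) + rank₃ Cl(ℚ_n(√−3d))` — Scholz's reflection at every layer of the `ℤ₃`-tower.

## Main results

* `natCard_torsion_classGroup_layer_eq` — `#Cl(K_m)[p] = p ^ classGroupPRank κ m`.
* (private) `isTotallyReal_of_isGalois_of_odd_finrank`, `isTotallyReal_layer` — odd-degree Galois extensions of a totally real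
  field (e.g. the layers `F_n`, `p` odd) are totally real.
* `natCard_torsion_classGroup_fixedField_reflection_le` — the one-field inequality (`K` CM ∋ `ζ_p`, `z, b` as above):
  `#Cl(K^{⟨z⟩})[p] · #Cl(K^{⟨z,b⟩})[p]² ≤ p · #Cl(K^{⟨b⟩})[p] · #Cl(K^{⟨zb⟩})[p]`.
* `classGroupPRank_restrict_reflection_le` — THE LAYERWISE INEQUALITY
  `rank_p Cl((L^{⟨z⟩}F_∞)_n) + 2 rank_p Cl((L^{⟨z,b⟩}F_∞)_n) ≤ 1 + rank_p Cl((L^{⟨b⟩}F_∞)_n) + rank_p Cl((L^{⟨zb⟩}F_∞)_n)`.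

## What is NOT here (honest scope)

No `p`-adic `L`-function, no `μ⁻ = 0`; no isotypic (character-by-character) refinement
(`-- TODO(general form): Leopoldt's Spiegelungssatz `rank_p A^{χ} ≤ rank_p A^{ωχ⁻¹} + δ_χ` component-wise [Washington1997,
Thm. 10.11]`); nothing about elliptic curves.  BSD is advanced for no curve by this file.

## References

* S. Lang, *Cyclotomic Fields I and II*, GTM 121 (1990), Ch. 13 §2, Thm. 2.1 (i) (pp. 199–200). [Lang1990]
* L. C. Washington, *Introduction to Cyclotomic Fields*, 2nd ed., GTM 83 (1997): §10.2 (Thm. 10.10 Scholz, Thm. 10.11 Leopoldt),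
  §13.1, §13.3 Prop. 13.23. [Washington1997]
* F. Lemmermeyer, *Kuroda's class number formula*, Acta Arith. 66 (1994) 245–260, §1. [Lemmermeyer1994]
* T. Fukuda, Proc. Japan Acad. 70 (1994), p. 264 (`rank`). [Fukuda1994]
* Tree: `NumberFields/KummerPlusMinusRankOne.lean` (Lang 2.1 (i)), `NumberFields/CMFieldClassGroupPlusMinusDecomposition.lean`,
  `NumberFields/KurodaRelationOddPart.lean`, `IwasawaTheory/RestrictedTowerLayerSection.lean`, `IwasawaTheory/ClassicalMuVanishesKurodaTower.lean`,
  `IwasawaTheory/FukudaRankCountingLemmas.lean`; Mathlib `NumberTheory/NumberField/CMField`.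
-/

noncomputable section

open scoped NumberField

open Field IntermediateField NumberField NumberField.InfinitePlace
  Literature.NumberTheory.GaloisRepresentations Literature.NumberTheory.EllipticCurves
  Literature.NumberTheory.EllipticCurves.ZpExtension Literature.NumberTheory.NumberFields

namespace Literature.NumberTheory.IwasawaTheory

/-! ### §0 Counting: `p`-torsion of a finite commutative group -/

section Counting

variable {M M' : Type*} [CommGroup M] [CommGroup M']

/-- `#{m : m^q = 1}` is invariant under isomorphism. [folklore] -/
private theorem natCard_torsion_congr (e : M ≃* M') (q : ℕ) :
    Nat.card {m : M // m ^ q = 1} = Nat.card {m : M' // m ^ q = 1} := by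
  refine Nat.card_congr (e.toEquiv.subtypeEquiv fun m => ?_)
  change m ^ q = 1 ↔ e m ^ q = 1
  rw [← map_pow, MulEquiv.map_eq_one_iff]

/-- `{m : m^q = 1}` is the kernel of `m ↦ m^q`. [folklore] -/
private theorem natCard_torsion_eq_natCard_ker (q : ℕ) :
    Nat.card {m : M // m ^ q = 1} = Nat.card (powMonoidHom q : M →* M).ker :=
  Nat.card_congr (Equiv.subtypeEquivRight fun m => by rw [MonoidHom.mem_ker, powMonoidHom_apply])

/-- For a finite commutative group, `#ker(m ↦ m^q) = [M : M^q]` (both equal `#M / #M^q`). [folklore] -/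
private theorem natCard_ker_pow_eq_index_range [Finite M] (q : ℕ) :
    Nat.card (powMonoidHom q : M →* M).ker = (powMonoidHom q : M →* M).range.index := by
  have h1 := Subgroup.card_mul_index (powMonoidHom q : M →* M).ker
  rw [Subgroup.index_ker] at h1
  have h2 := Subgroup.card_mul_index (powMonoidHom q : M →* M).range
  have hr : 0 < Nat.card (powMonoidHom q : M →* M).range := Nat.card_pos
  refine Nat.eq_of_mul_eq_mul_right hr ?_
  rw [h1, ← h2, mul_comm]

/-- `1 ≤ #{m : m^q = 1}` (it contains `1`). [folklore] -/
private theorem one_le_natCard_torsion [Finite M] (q : ℕ) : 1 ≤ Nat.card {m : M // m ^ q = 1} := by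
  haveI : Nonempty {m : M // m ^ q = 1} := ⟨⟨1, one_pow q⟩⟩
  exact Nat.one_le_iff_ne_zero.mpr Nat.card_pos.ne'

end Counting

/-- **`#{c ∈ Cl(K_m) : c^p = 1} = p ^ rank_p Cl(K_m)`** for the layers of a `ℤ_p`-extension of a number field
(`rank_p = dim_{𝔽_p} Cl/Cl^p`, tree `classGroupPRank`; `#Cl[p] = #(Cl/Cl^p)` for a finite abelian group).
[cite: Fukuda1994, p. 264 (definition of `rank(M)`)] [cite: Washington1997, §13.3 (proof of Prop. 13.23)] -/
theorem natCard_torsion_classGroup_layer_eq {K : Type} [Field K] [NumberField K] {p : ℕ} [Fact p.Prime]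
    (κ : ZpExtension K p) (m : ℕ) :
    Nat.card {c : ClassGroup (𝓞 ↥(κ.layer m)) // c ^ p = 1} = p ^ classGroupPRank κ m := by
  haveI : FiniteDimensional K (κ.layer m) := κ.finiteDimensional_layer_holds m
  haveI : NumberField (κ.layer m) := NumberField.of_module_finite K _
  obtain ⟨c, hc⟩ := NumberFields.index_range_powMonoidHom_eq_prime_pow (K := ↥(κ.layer m)) p
  rw [natCard_torsion_eq_natCard_ker, natCard_ker_pow_eq_index_range, classGroupPRank_def,
    ← Subgroup.index_eq_card, hc, padicValNat.prime_pow]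

/-! ### §1 Totally real layers: a Galois extension of odd degree of a totally real field is totally real -/

/-- **A finite Galois extension of ODD degree of a totally real field is totally real**: a complex place over a real
one is ramified, and a ramified infinite place forces `2 ∣ [K : k]` (its decomposition group has order `2`).
In particular every layer `F_n` (`[F_n : F] = pⁿ`, `p` odd) of a `ℤ_p`-extension of a totally real `F` is totally real.
[cite: Washington1997, §13.1] [folklore] -/
private theorem isTotallyReal_of_isGalois_of_odd_finrank (k K : Type*) [Field k] [NumberField k] [IsTotallyReal k]
    [Field K] [NumberField K] [Algebra k K] [IsGalois k K] (hodd : Odd (Module.finrank k K)) :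
    IsTotallyReal K where
  isReal w := by
    have hun : w.IsUnramified k := by
      by_contra h
      exact (Nat.not_even_iff_odd.mpr hodd) (even_finrank_of_not_isUnramified h)
    rcases isUnramified_iff.mp hun with h | h
    · exact h
    · exact absurd (IsTotallyReal.isReal (w.comap (algebraMap k K))) (not_isReal_iff_isComplex.mpr h)

/-- The `n`-th layer of a `ℤ_p`-extension (`p` odd) of a totally real number field is totally real. [cite: Washington1997, §13.1] -/
private theorem isTotallyReal_layer {F : Type} [Field F] [NumberField F] [IsTotallyReal F] {p : ℕ} [Fact p.Prime]
    (hp2 : p ≠ 2) (κ : ZpExtension F p) (n : ℕ) : IsTotallyReal ↥(κ.layer n) := by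
  haveI : FiniteDimensional F (κ.layer n) := κ.finiteDimensional_layer_holds n
  haveI : NumberField (κ.layer n) := NumberField.of_module_finite F _
  haveI : IsGalois F (κ.layer n) := κ.isGalois_layer_holds n
  refine isTotallyReal_of_isGalois_of_odd_finrank F _ ?_
  rw [κ.finrank_layer_holds n]
  exact Odd.pow ((Fact.out : p.Prime).odd_of_ne_two hp2)


/-- The compositum of two totally real intermediate fields (inside any field algebraic over `ℚ`) is totally real
(Mathlib's `isTotallyReal_sup` for subfields, moved to `IntermediateField`). [folklore] -/
private theorem isTotallyReal_sup_intermediateField {k Ω : Type*} [Field k] [Field Ω] [CharZero Ω] [Algebra k Ω]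
    [Algebra.IsAlgebraic ℚ Ω] (A B : IntermediateField k Ω) [hA : IsTotallyReal ↥A] [hB : IsTotallyReal ↥B] :
    IsTotallyReal ↥(A ⊔ B) := by
  -- move to subfields of `Ω`
  have eA : ↥A ≃+* ↥A.toSubfield := RingEquiv.refl _
  have eB : ↥B ≃+* ↥B.toSubfield := RingEquiv.refl _
  haveI : IsTotallyReal ↥A.toSubfield := IsTotallyReal.ofRingEquiv eA
  haveI : IsTotallyReal ↥B.toSubfield := IsTotallyReal.ofRingEquiv eB
  have h : IsTotallyReal ↥(A.toSubfield ⊔ B.toSubfield) := isTotallyReal_sup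
  have e : ↥(A.toSubfield ⊔ B.toSubfield) ≃+* ↥(A ⊔ B) :=
    RingEquiv.subfieldCongr (IntermediateField.sup_toSubfield A B).symm
  exact IsTotallyReal.ofRingEquiv e

/-! ### §2 REFLECTION at one CM field: Lang's Thm. 2.1 (i) + the `±` decomposition + Kuroda's relation -/

/-- **Leopoldt–Scholz reflection for a biquadratic CM configuration (one field).**  `K/F` finite Galois number fields,
`p` an odd prime, `ζ ∈ K` a primitive `p`-th root of unity, `K` totally complex, `z, b ∈ Gal(K/F)` commuting involutions,
`z ≠ 1`, with `K^{⟨z⟩}` TOTALLY REAL (so `K` is CM with complex conjugation `z`).  Then, with `N_E := #{c ∈ Cl(E) : c^p = 1}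
= p^{rank_p Cl(E)}`:
  **`N_{K^{⟨z⟩}} · N_{K^{⟨z,b⟩}}² ≤ p · N_{K^{⟨b⟩}} · N_{K^{⟨zb⟩}}`**, i.e.
  `rank_p Cl(K⁺) + 2·rank_p Cl(K^{⟨z,b⟩}) ≤ 1 + rank_p Cl(K^{⟨b⟩}) + rank_p Cl(K^{⟨zb⟩})`.
Proof: Lang's Thm. 2.1 (i) `#Cl(K⁺)[p] ≤ p · #Cl(K)⁻[p]` (tree `IsCMField.card_pTorsion_classGroup_maximalRealSubfield_le_mul`,
on the tree's Hilbert class field) and `#Cl(K)[p] = #Cl(K⁺)[p] · #Cl(K)⁻[p]` (`IsCMField.card_pTorsion_classGroup`) give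
`#Cl(K⁺)[p]² ≤ p · #Cl(K)[p]`; Kuroda's relation (odd part, `q = p`; `KurodaOddPart.card_torsion_classGroup_biquadratic`)
`N_K · N_{K^{⟨z,b⟩}}² = N_{K^{⟨z⟩}} N_{K^{⟨b⟩}} N_{K^{⟨zb⟩}}`; and `K⁺ = K^{⟨z⟩}` (`CMExtension.equivMaximalRealSubfield`).  This is
the reflection inequality `rank_p A(χ_even) ≤ rank_p A(χ_odd) + δ` of Leopoldt's Spiegelungssatz for the mirror pair cut out by
`z`/`zb` (Scholz 1932 for `F = ℚ`, `p = 3`, `K = ℚ(√d, √−3)`: `r₃(ℚ(√d)) ≤ r₃(ℚ(√−3d)) + 1` up to the `K^{⟨b⟩} = ℚ(√−3)` term,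
which has trivial `3`-class group), obtained WITHOUT Kummer generators from Lang's `±`-form.
[cite: Lang1990, Ch. 13 §2, Thm. 2.1 (i) (pp. 199–200)] [cite: Washington1997, §10.2 Thm. 10.10 (Scholz), Thm. 10.11 (Leopoldt)]
[cite: Lemmermeyer1994, §1 (Kuroda's class number formula, odd part)] -/
theorem natCard_torsion_classGroup_fixedField_reflection_le (F K : Type) [Field F] [NumberField F] [Field K]
    [NumberField K] [Algebra F K] [IsGalois F K] [IsTotallyComplex K] {p : ℕ} [hp : Fact p.Prime] (hp2 : p ≠ 2)
    {ζ : K} (hζ : IsPrimitiveRoot ζ p) (z b : K ≃ₐ[F] K) (hz : z * z = 1) (hb : b * b = 1) (hzb : z * b = b * z)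
    (hz1 : z ≠ 1) (hreal : IsTotallyReal ↥(fixedField (Subgroup.zpowers z))) :
    Nat.card {d : ClassGroup (𝓞 ↥(fixedField (Subgroup.zpowers z))) // d ^ p = 1} *
        Nat.card {d : ClassGroup (𝓞 ↥(fixedField (Subgroup.closure ({z, b} : Set (K ≃ₐ[F] K))))) //
          d ^ p = 1} ^ 2 ≤
      p * Nat.card {d : ClassGroup (𝓞 ↥(fixedField (Subgroup.zpowers b))) // d ^ p = 1} *
        Nat.card {d : ClassGroup (𝓞 ↥(fixedField (Subgroup.zpowers (z * b)))) // d ^ p = 1} := by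
  classical
  haveI : FiniteDimensional F K := Module.Finite.of_restrictScalars_finite ℚ F K
  -- Kuroda's relation at `q = p`
  have hK := KurodaOddPart.card_torsion_classGroup_biquadratic F K z b hz hb hzb (hp.out.odd_of_ne_two hp2)
  -- the CM structure: `K⁺ = K^{⟨z⟩}`
  set F₀ : IntermediateField F K := fixedField (Subgroup.zpowers z) with hF₀
  haveI : IsTotallyReal ↥F₀ := hreal
  have horder : orderOf z = 2 := orderOf_eq_prime (by rw [pow_two, hz]) hz1
  haveI : Algebra.IsQuadraticExtension ↥F₀ K :=
    { toFree := Module.Free.of_divisionRing ↥F₀ K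
      finrank_eq_two' := by rw [hF₀, finrank_fixedField_eq_card, Nat.card_zpowers, horder] }
  haveI : IsCMField K := IsCMField.ofCMExtension ↥F₀ K
  let eR : ↥F₀ ≃+* ↥(maximalRealSubfield K) := CMExtension.equivMaximalRealSubfield ↥F₀ K
  have hA : Nat.card {d : ClassGroup (𝓞 ↥F₀) // d ^ p = 1} =
      Nat.card (powMonoidHom p : ClassGroup (𝓞 ↥(maximalRealSubfield K)) →*
        ClassGroup (𝓞 ↥(maximalRealSubfield K))).ker := by
    rw [natCard_torsion_congr (ClassGroup.mulEquiv (RingOfIntegers.mapRingEquiv eR)) p,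
      natCard_torsion_eq_natCard_ker]
  have hT : Nat.card {c : ClassGroup (𝓞 K) // c ^ p = 1} =
      Nat.card (powMonoidHom p : ClassGroup (𝓞 K) →* ClassGroup (𝓞 K)).ker :=
    natCard_torsion_eq_natCard_ker p
  -- Lang's Thm. 2.1 (i) and the `±` decomposition: `A² ≤ p · T`
  have hLang := IsCMField.card_pTorsion_classGroup_maximalRealSubfield_le_mul K hp.out hp2 hζ
  have hpm := IsCMField.card_pTorsion_classGroup K hp.out hp2
  set A := Nat.card {d : ClassGroup (𝓞 ↥F₀) // d ^ p = 1} with hAdef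
  set T := Nat.card {c : ClassGroup (𝓞 K) // c ^ p = 1} with hTdef
  set Bm := Nat.card ↥((powMonoidHom p : ClassGroup (𝓞 K) →* ClassGroup (𝓞 K)).ker ⊓
      (classGroupNorm (maximalRealSubfield K) K).ker) with hBm
  rw [← hA] at hLang hpm
  rw [← hT] at hpm
  -- `hLang : A ≤ p * Bm`, `hpm : T = A * Bm`
  have hA2 : A * A ≤ p * T := by
    rw [hpm]
    calc A * A ≤ A * (p * Bm) := Nat.mul_le_mul_left A hLang
      _ = p * (A * Bm) := by ring
  -- combine with Kuroda `T * C² = A * B * W`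
  set C := Nat.card {d : ClassGroup (𝓞 ↥(fixedField (Subgroup.closure ({z, b} : Set (K ≃ₐ[F] K))))) //
      d ^ p = 1} with hCdef
  set B' := Nat.card {d : ClassGroup (𝓞 ↥(fixedField (Subgroup.zpowers b))) // d ^ p = 1} with hB'
  set W := Nat.card {d : ClassGroup (𝓞 ↥(fixedField (Subgroup.zpowers (z * b)))) // d ^ p = 1} with hW
  have hApos : 0 < A := one_le_natCard_torsion p
  have key : A * (A * C ^ 2) ≤ A * (p * B' * W) := by
    calc A * (A * C ^ 2) = (A * A) * C ^ 2 := by ring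
      _ ≤ (p * T) * C ^ 2 := Nat.mul_le_mul_right _ hA2
      _ = p * (T * C ^ 2) := by ring
      _ = p * (A * B' * W) := by rw [hK]
      _ = A * (p * B' * W) := by ring
  exact Nat.le_of_mul_le_mul_left key hApos

/-! ### §3 Reflection up the tower: the layerwise `p`-rank inequality -/

section Tower

variable {F : Type} [Field F] [NumberField F] {p : ℕ} [hp : Fact p.Prime]

/-- The `p`-torsion count of the class group of the fixed field `(L·F_n)^{s(H)} = L^H·F_n` is `p ^ rank_p Cl((L^H·F_∞)_n)`
(the section `s` of `exists_section_fixedField_map_eq`; class groups along the `F`-isomorphism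
`(L^H·F_∞)_n ≃ j(L^H)·F_n = (L·F_n)^{s(H)}`). [cite: Washington1997, §13.1] -/
private theorem natCard_torsion_fixedField_map_eq (κ : ZpExtension F p) (L : Type) [Field L] [NumberField L]
    [Algebra F L] [IsGalois F L] (n : ℕ)
    (s : (L ≃ₐ[F] L) →*
      (↥((absEmbedding F L).fieldRange ⊔ κ.layer n) ≃ₐ[F] ↥((absEmbedding F L).fieldRange ⊔ κ.layer n)))
    (hfix : ∀ H : Subgroup (L ≃ₐ[F] L), IntermediateField.lift (fixedField (H.map s)) =
      IntermediateField.map (absEmbedding F L) (fixedField H) ⊔ κ.layer n)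
    (H : Subgroup (L ≃ₐ[F] L))
    (hH : Function.Surjective (κ.toContinuousMonoidHom.comp (absGaloisRestrict F ↥(fixedField H)))) :
    Nat.card {d : ClassGroup (𝓞 ↥(fixedField (H.map s))) // d ^ p = 1} =
      p ^ classGroupPRank (κ.restrict ↥(fixedField H) hH) n := by
  haveI : FiniteDimensional F L := Module.Finite.of_restrictScalars_finite ℚ F L
  haveI := isGalois_fieldRange_sup_layer κ L (absEmbedding F L) n
  haveI := finiteDimensional_fieldRange_sup_layer κ L (absEmbedding F L) n
  haveI := numberField_fieldRange_sup_layer κ L (absEmbedding F L) n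
  have e₁ : ↥(fixedField (H.map s)) ≃ₐ[F] ↥(IntermediateField.map (absEmbedding F L) (fixedField H) ⊔ κ.layer n) :=
    (IntermediateField.liftAlgEquiv (fixedField (H.map s))).trans (IntermediateField.equivOfEq (hfix H))
  obtain ⟨e₂⟩ := nonempty_algEquiv_layer_restrict_fieldRange_sup_layer κ ↥(fixedField H) hH
    ((absEmbedding F L).comp (fixedField H).val) n
  rw [IntermediateField.fieldRange_comp_val] at e₂
  rw [← natCard_torsion_classGroup_layer_eq (κ.restrict ↥(fixedField H) hH) n]
  exact (natCard_torsion_congr (ClassGroup.mulEquiv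
    (RingOfIntegers.mapRingEquiv (e₂.trans e₁.symm).toRingEquiv)) p).symm

/-- The compositum `e(L)·F_n ⊆ F̄` receives `L`, so it is totally complex when `L` is. [cite: Washington1997, §13.1] -/
private theorem isTotallyComplex_fieldRange_sup_layer (κ : ZpExtension F p) (L : Type) [Field L] [NumberField L]
    [Algebra F L] [IsTotallyComplex L] (n : ℕ) :
    IsTotallyComplex ↥((absEmbedding F L).fieldRange ⊔ κ.layer n) := by
  let eL : L →+* ↥((absEmbedding F L).fieldRange ⊔ κ.layer n) :=
    (absEmbedding F L : L →+* AlgebraicClosure F).codRestrict ((absEmbedding F L).fieldRange ⊔ κ.layer n) fun x =>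
      (le_sup_left : (absEmbedding F L).fieldRange ≤ (absEmbedding F L).fieldRange ⊔ κ.layer n)
        ((absEmbedding F L).mem_fieldRange.mpr ⟨x, rfl⟩)
  letI : Algebra L ↥((absEmbedding F L).fieldRange ⊔ κ.layer n) := eL.toAlgebra
  exact isTotallyComplex_of_algebra L _

/-- A primitive `p`-th root of unity of `L` gives one of `e(L)·F_n`. [cite: Washington1997, §13.1] -/
private theorem exists_isPrimitiveRoot_fieldRange_sup_layer (κ : ZpExtension F p) (L : Type) [Field L] [NumberField L]
    [Algebra F L] {q : ℕ} {ζ : L} (hζ : IsPrimitiveRoot ζ q) (n : ℕ) :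
    ∃ ζ' : ↥((absEmbedding F L).fieldRange ⊔ κ.layer n), IsPrimitiveRoot ζ' q := by
  let eL : L →+* ↥((absEmbedding F L).fieldRange ⊔ κ.layer n) :=
    (absEmbedding F L : L →+* AlgebraicClosure F).codRestrict ((absEmbedding F L).fieldRange ⊔ κ.layer n) fun x =>
      (le_sup_left : (absEmbedding F L).fieldRange ≤ (absEmbedding F L).fieldRange ⊔ κ.layer n)
        ((absEmbedding F L).mem_fieldRange.mpr ⟨x, rfl⟩)
  exact ⟨eL ζ, hζ.map_of_injective eL.injective⟩

/-- `(L·F_n)^{s(⟨z⟩)} = e(L^{⟨z⟩})·F_n` is totally real when `L^{⟨z⟩}` and `F` are (`F_n` is totally real: odd degree).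
[cite: Washington1997, §13.1] -/
private theorem isTotallyReal_fixedField_section [IsTotallyReal F] (hp2 : p ≠ 2) (κ : ZpExtension F p) (L : Type)
    [Field L] [NumberField L] [Algebra F L] [IsGalois F L] (n : ℕ)
    (s : (L ≃ₐ[F] L) →*
      (↥((absEmbedding F L).fieldRange ⊔ κ.layer n) ≃ₐ[F] ↥((absEmbedding F L).fieldRange ⊔ κ.layer n)))
    (hfix : ∀ H : Subgroup (L ≃ₐ[F] L), IntermediateField.lift (fixedField (H.map s)) =
      IntermediateField.map (absEmbedding F L) (fixedField H) ⊔ κ.layer n)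
    (z : L ≃ₐ[F] L) (hreal : IsTotallyReal ↥(fixedField (Subgroup.zpowers z))) :
    IsTotallyReal ↥(fixedField (Subgroup.zpowers (s z))) := by
  haveI : FiniteDimensional F L := Module.Finite.of_restrictScalars_finite ℚ F L
  haveI := finiteDimensional_fieldRange_sup_layer κ L (absEmbedding F L) n
  haveI : Algebra.IsAlgebraic ℚ (AlgebraicClosure F) := Algebra.IsAlgebraic.trans ℚ F (AlgebraicClosure F)
  haveI : IsTotallyReal ↥(fixedField (Subgroup.zpowers z)) := hreal
  haveI h1 : IsTotallyReal ↥(IntermediateField.map (absEmbedding F L) (fixedField (Subgroup.zpowers z))) :=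
    IsTotallyReal.ofRingEquiv ((fixedField (Subgroup.zpowers z)).equivMap (absEmbedding F L)).toRingEquiv
  haveI h2 : IsTotallyReal ↥(κ.layer n) := isTotallyReal_layer hp2 κ n
  haveI h3 : IsTotallyReal ↥(IntermediateField.map (absEmbedding F L) (fixedField (Subgroup.zpowers z)) ⊔ κ.layer n) :=
    isTotallyReal_sup_intermediateField _ _
  have hsub : Subgroup.zpowers (s z) = (Subgroup.zpowers z).map s := (MonoidHom.map_zpowers s z).symm
  have e₁a : ↥(fixedField (Subgroup.zpowers (s z))) ≃ₐ[F] ↥(fixedField ((Subgroup.zpowers z).map s)) :=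
    IntermediateField.equivOfEq (congrArg fixedField hsub)
  have e₁b : ↥(fixedField ((Subgroup.zpowers z).map s)) ≃ₐ[F]
      ↥(IntermediateField.lift (fixedField ((Subgroup.zpowers z).map s))) :=
    IntermediateField.liftAlgEquiv _
  have e₁c : ↥(IntermediateField.lift (fixedField ((Subgroup.zpowers z).map s))) ≃ₐ[F]
      ↥(IntermediateField.map (absEmbedding F L) (fixedField (Subgroup.zpowers z)) ⊔ κ.layer n) :=
    IntermediateField.equivOfEq (hfix (Subgroup.zpowers z))
  exact IsTotallyReal.ofRingEquiv ((e₁a.trans e₁b).trans e₁c).symm.toRingEquiv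

/-- **REFLECTION UP THE CYCLOTOMIC TOWER (layerwise `p`-rank inequality).**  `F` a TOTALLY REAL number field, `p` an odd
prime, `κ` a `ℤ_p`-extension of `F` (layers `F_n`), `L/F` finite Galois with `κ ∘ res` onto (`L ∩ F_∞ = F`), `L` totally complex
and containing a primitive `p`-th root of unity, `z, b ∈ Gal(L/F)` commuting involutions with `z ≠ 1` and `L^{⟨z⟩}` totally real
(`L` is CM with complex conjugation `z`).  Then FOR EVERY `n`, writing `r(E) := rank_p Cl((E·F_∞)_n)`:
  **`r(L^{⟨z⟩}) + 2·r(L^{⟨z,b⟩}) ≤ 1 + r(L^{⟨b⟩}) + r(L^{⟨zb⟩})`.**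
The layer `L·F_n` is again CM (`F_n` is totally real: odd degree, `isTotallyReal_layer`; `(L·F_n)⁺ = L^{⟨z⟩}·F_n`), contains
`ζ_p`, and the lift `s(z), s(b)` of `z, b` (`exists_section_fixedField_map_eq`) is a pair of commuting involutions of
`Gal(L·F_n/F)` whose fixed fields are the layers of the four sub-towers; apply `natCard_torsion_classGroup_fixedField_reflection_le`.
For `F = ℚ`, `p = 3`, `L = ℚ(√d, √−3)`: `rank₃ Cl(ℚ_n(√d)) ≤ 1 + rank₃ Cl(ℚ(μ_{3^{n+1}})) + rank₃ Cl(ℚ_n(√−3d))` — Scholz's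
reflection theorem at every layer of the cyclotomic `ℤ₃`-tower.
[cite: Lang1990, Ch. 13 §2, Thm. 2.1 (i) (pp. 199–200)] [cite: Washington1997, §10.2 Thm. 10.10–10.11, §13.1]
[cite: Lemmermeyer1994, §1 (Kuroda's class number formula, odd part)] -/
theorem classGroupPRank_restrict_reflection_le [IsTotallyReal F] (hp2 : p ≠ 2) (κ : ZpExtension F p) (L : Type)
    [Field L] [NumberField L] [Algebra F L] [IsGalois F L] [IsTotallyComplex L]
    (hL : Function.Surjective (κ.toContinuousMonoidHom.comp (absGaloisRestrict F L)))
    {ζ : L} (hζ : IsPrimitiveRoot ζ p) {z b : L ≃ₐ[F] L} (hz : z * z = 1) (hb : b * b = 1) (hzb : z * b = b * z)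
    (hz1 : z ≠ 1) (hreal : IsTotallyReal ↥(fixedField (Subgroup.zpowers z)))
    (hZ : Function.Surjective (κ.toContinuousMonoidHom.comp (absGaloisRestrict F ↥(fixedField (Subgroup.zpowers z)))))
    (hB : Function.Surjective (κ.toContinuousMonoidHom.comp (absGaloisRestrict F ↥(fixedField (Subgroup.zpowers b)))))
    (hZB' : Function.Surjective
      (κ.toContinuousMonoidHom.comp (absGaloisRestrict F ↥(fixedField (Subgroup.zpowers (z * b))))))
    (hC : Function.Surjective
      (κ.toContinuousMonoidHom.comp (absGaloisRestrict F ↥(fixedField (Subgroup.closure {z, b})))))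
    (n : ℕ) :
    classGroupPRank (κ.restrict ↥(fixedField (Subgroup.zpowers z)) hZ) n +
        2 * classGroupPRank (κ.restrict ↥(fixedField (Subgroup.closure {z, b})) hC) n ≤
      1 + classGroupPRank (κ.restrict ↥(fixedField (Subgroup.zpowers b)) hB) n +
        classGroupPRank (κ.restrict ↥(fixedField (Subgroup.zpowers (z * b))) hZB') n := by
  classical
  haveI : FiniteDimensional F L := Module.Finite.of_restrictScalars_finite ℚ F L
  haveI := isGalois_fieldRange_sup_layer κ L (absEmbedding F L) n
  haveI := finiteDimensional_fieldRange_sup_layer κ L (absEmbedding F L) n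
  haveI := numberField_fieldRange_sup_layer κ L (absEmbedding F L) n
  haveI := isTotallyComplex_fieldRange_sup_layer κ L n
  obtain ⟨ζ', hζ'⟩ := exists_isPrimitiveRoot_fieldRange_sup_layer κ L hζ n
  obtain ⟨s, hs_inj, hfix, -⟩ := exists_section_fixedField_map_eq κ L hL n
  -- the four counts at layer `n`
  have eZ := natCard_torsion_fixedField_map_eq κ L n s hfix (Subgroup.zpowers z) hZ
  have eB := natCard_torsion_fixedField_map_eq κ L n s hfix (Subgroup.zpowers b) hB
  have eW := natCard_torsion_fixedField_map_eq κ L n s hfix (Subgroup.zpowers (z * b)) hZB'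
  have eC := natCard_torsion_fixedField_map_eq κ L n s hfix (Subgroup.closure {z, b}) hC
  rw [MonoidHom.map_zpowers] at eZ eB eW
  rw [map_mul] at eW
  rw [MonoidHom.map_closure, Set.image_pair] at eC
  -- the involutions `s z`, `s b` of `Gal(L·F_n/F)`
  have hz' : s z * s z = 1 := by rw [← map_mul, hz, map_one]
  have hb' : s b * s b = 1 := by rw [← map_mul, hb, map_one]
  have hzb' : s z * s b = s b * s z := by rw [← map_mul, hzb, map_mul]
  have hz1' : s z ≠ 1 := fun h => hz1 (hs_inj (by rw [h, map_one]))
  have hrealn := isTotallyReal_fixedField_section hp2 κ L n s hfix z hreal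
  -- reflection at the CM field `L·F_n`
  have hmain := natCard_torsion_classGroup_fixedField_reflection_le F ↥((absEmbedding F L).fieldRange ⊔ κ.layer n)
    hp2 hζ' (s z) (s b) hz' hb' hzb' hz1' hrealn
  simp only [eZ, eB, eW, eC] at hmain
  have hp1 : 1 < p := hp.out.one_lt
  have key : p ^ (classGroupPRank (κ.restrict ↥(fixedField (Subgroup.zpowers z)) hZ) n +
      2 * classGroupPRank (κ.restrict ↥(fixedField (Subgroup.closure {z, b})) hC) n) ≤
      p ^ (1 + classGroupPRank (κ.restrict ↥(fixedField (Subgroup.zpowers b)) hB) n +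
        classGroupPRank (κ.restrict ↥(fixedField (Subgroup.zpowers (z * b))) hZB') n) := by
    calc _ = p ^ classGroupPRank (κ.restrict ↥(fixedField (Subgroup.zpowers z)) hZ) n *
          (p ^ classGroupPRank (κ.restrict ↥(fixedField (Subgroup.closure {z, b})) hC) n) ^ 2 := by
            rw [pow_add, ← pow_mul, mul_comm 2, pow_mul]
      _ ≤ p * p ^ classGroupPRank (κ.restrict ↥(fixedField (Subgroup.zpowers b)) hB) n *
          p ^ classGroupPRank (κ.restrict ↥(fixedField (Subgroup.zpowers (z * b))) hZB') n := hmain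
      _ = _ := by rw [pow_add, pow_add, pow_one]
  exact (Nat.pow_le_pow_iff_right hp1).mp key

end Tower

end Literature.NumberTheory.IwasawaTheory

end
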